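import Mathlib
import HarnessLib
import HarnessLib.Audit
import Summits.MatrixMultiplication.Statement
import Literature.Computability.AlgebraicComplexity.SchoenhageTau
import Literature.Computability.AlgebraicComplexity.FlatteningBound
import Literature.Computability.AlgebraicComplexity.CoppersmithWinograd1982Crude
import HarnessLib.Audit.Status.Attr

/-!
Route: HollowSchoolbook

DORMANT since 2026-08-24T06:57:51Z (reconciler: no traction for 6.6 d (last activity item-evidence-added at 2026-08-17T16:37:18Z); parked, not closed — `ledger route dormant route-MatrixMultiplication-HollowSchoolbook --off` to reactiva) — unstaffed, not closed; items shared with open routes are served there. `ledger route dormant <id> --off` reactivates.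

# Route HollowSchoolbook — each extra column costs a+b-1 in border rank; the column step gives
bR<n,n,n> <= 3n^2-3n+1 and omega = 2

STRENGTHEN lens (inventor's paradox on the matrix FORMAT). It suffices to show X = the UPPER HOLLOW
LAW: for all a, b, c >= 1,
bR<a,b,c> <= abc - (a-1)(b-1)(c-1) = ab + (c-1)(a+b-1), bR = the algebraic border rank over C[eps]
(`algBorderRank`, Blaser 2013
Def. 6.1), i.e. "matrix multiplication costs its surface, not its volume" (card
hollow-schoolbook-law, upper half only). X is strictly
stronger than the summit and is generated by ONE inductive statement, the COLUMN STEP (crux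
ColumnStep): bR<a,b,c+1> <= bR<a,b,c> +
(a+b-1) — a (c+1)-st column of B, sharing A with the first c columns, costs the dimension a+b-1 of
the cone over Seg(P^{a-1} x P^{b-1})
instead of ab: the (a-1)(b-1) interior products ride free. On cubes X reads bR<n,n,n> <= 3n^2 - 3n +
1 <= 3n^2, and Bini's inequality
n^omega <= bR<n,n,n> (in tree) gives omega(C) = 2. Written over N with shifted variables (a+1, b+1,
c+1 >= 1).
Lean: `∀ a b c : ℕ, Literature.Computability.AlgebraicComplexity.algBorderRank
(Literature.Computability.AlgebraicComplexity.matMulTensor ℂ (a + 1) (b + 1) (c + 1)) + a * b * c ≤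
(a + 1) * (b + 1) * (c + 1)`

## Assembly
ColumnStep =>(induction on c, StepGivesHollow) HollowUpper =>(a = b = c = n) bR<n,n,n> + (n-1)^3 <=
n^3, so bR<n,n,n> <= 3n^2; Bini /
the one-block asymptotic sum inequality for the border rank,
`rpow_omega_div_three_le_algBorderRank_matMulTensor` (PROVED in tree):
n^omega = (n n n)^{omega/3} <= bR<n,n,n> <= 3n^2 <= n^{2+eps} as soon as n^eps >= 3, hence omega <=
2 + eps for every eps > 0
(`Real.rpow_le_rpow_left_iff`), and omega >= 2 is `omega_two_le`. The deciding theorem `closes :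
ColumnStep → MatrixMultiplication` in
glue.lean carries out exactly this (75 lines, elaborates sorry-free in Sketch.lean); the cruxes
ranked 3–6 are INSTANCES of ColumnStep /
HollowUpper (TwoColumns = the step at c = 1 for square A; CubeNineteen = X at (3,3,3); FourFourTwo =
TwoColumns at n = 4; TowerTwoTwo =
the (2,2) tower), filed as the refuters' and certifiers' handles, not as hypotheses of the assembly.

Rationale: WHY THIS LINE. The three exactly known non-trivial border ranks of matrix multiplication are 7
(Landsberg2005), 10 and 14 (ConnerHarperLandsberg2023
Thms 1.3, 1.4), and all three say the same thing: gluing two one-column products <a,b,1> (border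
rank ab each) along the shared matrix A
saves exactly (a-1)(b-1) — 7 = 4+4-1, 10 = 6+6-2 (<2,3,2>), 14 = 9+9-4 (<3,3,2>); the printed tower
bounds 13, 16 for <2,2,4>, <2,2,5>
(BiniEtAl1979 / AlekseevSmirnov2013 reduced tensors glued as in LandsbergGCT2017 Ex. 3.2.2.1) and
Landsberg's expectation bR<n,2,2> <=
3n+1 (LandsbergGCT2017 §4.8) are the (a,b) = (2,2) tower of the same marginal law. The route takes
that marginal law as an INDUCTION
on the number of columns — the structure the bare summit lacks: the inductive object <a,b,c> +_A
<a,b,1> is a finite tensor at every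
step, each step is a finite border-identity problem in a fixed small format, and the induction
(ColumnStep => X => omega = 2) is
machine-checked in the deciding theorem. Imported: border-rank geometry of small formats (secant
varieties, reduced-tensor gluing,
border apolarity for the confirming lower halves); no laser method, no intermediate tensor, no group
host — so none of the
fixed-tensor or design barriers is in play, and InfimumNotMinimum is respected because no single n
certifies 2 (log_n(3n^2-3n+1) =
2.81, 2.68, 2.60, ... -> 2). No open route attacks omega through an explicit law on rectangular
formats; ShapeSubmodularity and EPRFaces
posit inequalities / slopes of the same table (shared numerology beta(n) = 2n-1), StrassenDefect
inducts multiplicatively on the SIZE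
with junk, TropicalBiniPatterns enumerates border identities for direct sums; the negatives index
(designs, S_n triples) is untouched.

RANKED CRUXES. #0 HollowUpper (target) — the upper hollow law X: for all a, b, c >= 1, bR<a,b,c> +
(a-1)(b-1)(c-1) <= abc (shifted variables). (why it might fail: maximal optimism made precise: it
predicts bR<n,n,n> <= 3n^2-3n+1 (19, 37, 61) while every known construction is >= n^2.37; any lower
bound above abc-(a-1)(b-1)(c-1) at ONE cell (first candidate: bR<3,3,3> = 20) kills it.)
[ConnerHarperLandsberg2023, Landsberg2005, LandsbergGCT2017, LandsbergMichalek2018, Bini1980]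
#2 ColumnStep (crux) — the COLUMN STEP (card K3): for all a, b, c >= 1, bR<a,b,c+1> <= bR<a,b,c> + a
+ b - 1 — the new column's (a-1)(b-1) interior products are absorbed into eps-cross-terms of the
existing scheme, only the hook of a+b-1 products is paid (shifted: a+1, b+1, c+1). [difficulty:
open-problem] (why it might fail: bR<3,3,3> = 20 refutes it at (3,3,2->3) since bR<3,3,2> = 14 is
known; no uniform absorbing construction exists beyond the (2,2) reduced-tensor gluing, and the
naive Schönhage transfer fails (its order-0 junk Sum A_ij beta_j gamma'_i has rank ab, not 1).)
[LandsbergGCT2017, ConnerHarperLandsberg2023, BiniEtAl1979, AlekseevSmirnov2013, Schonhage1981]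
#3 TwoColumns (crux) — the first column step for square A: bR<n,n,2> <= n^2 + 2n - 1 = (n+1)^2 - 2
for all n >= 1 — an n x n matrix times TWO vectors costs barely more than one matrix–vector product
in the border limit (shifted: n+1); proved for n <= 3 (7; 14 = bR<3,3,2> by CHL Thm 1.4 and cyclic
symmetry). [difficulty: L] (why it might fail: asks a factor-2 border saving (n^2+2n-1 vs 2n^2) with
no construction for n >= 4 (first open cell <4,4,2> @ 23 vs printed 26 = 2 bR<2,2,4>); a Koszul /
Kronecker–Koszul flattening bound >= n^2+2n at any single n kills it.) [Landsberg2005,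
ConnerHarperLandsberg2023, LandsbergOttaviani2015, HopcroftKerr1971, arXiv:2602.12762]
#4 CubeNineteen (crux) — the first open cube cell: bR<3,3,3> <= 19 (printed window [17,20]: CHL 2023
Thm 1.1 and Smirnov's numerical border scheme of length 20); = ColumnStep at (3,3,2) on top of the
theorem bR<3,3,2> = 14. [difficulty: L] (why it might fail: every numerical search since Smirnov
2013 stops at 20, and CHL's Borel-fixed census at r = 18, 19 (their named next step) or a
Kronecker–Koszul flattening may prove bR<3,3,3> = 20.) [Smirnov2013, ConnerHarperLandsberg2023,
LandsbergGCT2017, arXiv:2602.12762]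
#5 FourFourTwo (crux) — the cheapest new cell: bR<4,4,2> <= 23 (= TwoColumns at n = 4; <4,4,2> ~
<2,4,4> cyclically; printed: R<2,4,4> = 26, bR <= 26 via 2 x bR<2,2,4> = 2 x 13) — a computational
crux: an approximate scheme of length 23 in format 16 x 8 x 8 with a rational eps-certificate.
[difficulty: M] (why it might fail: needs a scheme 3 below anything printed for <2,4,4>; plain ALS
with eps-parametrisation did not even re-find the known <2,2,4>@13 / <3,3,3>@20 in hub probes (card
j003631), so structure (Z_2 x Z_2 symmetry, reduced-tensor gluing) must seed the search.)
[AlekseevSmirnov2013, HopcroftKerr1971, arXiv:2606.13408, Smirnov2013]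
#6 TowerTwoTwo (crux) — Landsberg's expectation for the (2,2) tower: bR<2,2,c> <= 3c + 1 for all c
>= 1 (shifted: c+1); = ColumnStep at (a,b) = (2,2); known for c <= 5 (4, 7, 10, 13, 16) by gluing
the reduced tensors M^red_<2,2,2> (BCLR, 5) and M^red_<3,2,2> (Alekseev–Smirnov, 8). [difficulty: L]
(why it might fail: needs bR(M^red_<m,2,2>) <= 3m-1 for all m (printed only for m <= 3) or another
gluing; Landsberg–Ryder's geometry of the limit planes (three lines / conic + P^1 x P^1) may not
persist for m >= 4, and a lower bound 3c+2 at one c kills it.) [LandsbergGCT2017, BiniEtAl1979,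
AlekseevSmirnov2013, LandsbergMichalek2018]
#9 StepGivesHollow (support) — the column step gives the upper hollow law by induction on the number
of columns (base bR<a,b,1> <= ab = the standard algorithm; the step adds a+b-1 and ab + (c-1)(a+b-1)
+ (a+b-1) = ab + c(a+b-1)); PROVED sorry-free in the planner's Sketch.lean (nlinarith bookkeeping),
to be re-landed by a prover. [difficulty: provable-now] [LandsbergGCT2017, Blaser2013]

TWO-LAYER PLAN. ColumnStep ⇐ ReducedProfile → ReducedGluing → ColumnStep: the (a,b)-generalisation
of LandsbergGCT2017 Ex. 3.2.2.1 — a REDUCED tensor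
<a,b,c>^red (last column of B partially filled) whose border rank sits (a-1)(b-1)-type savings below
the full one, and additivity of
two reduced tensors glued along the shared column (k + (b-k) entries); at (2,2) this is BCLR 5 +
Alekseev–Smirnov 8. TwoColumns ⇐
FourFourTwo → a uniform <n,n,2> scheme (guess-and-verify from n = 2, 3, 4, e.g. a holonomic ansatz
in n for the eps-scheme entries).
CubeNineteen ⇐ symmetric-ansatz search (Z_3 x Z_2 of Smirnov's 20, CHL's Borel-fixed E_110
candidates) → rational eps-certificate
checked in tree.

KILL CRITERIA. bR<3,3,3> >= 20 proved (border apolarity census / Kronecker–Koszul flattening)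
refutes CubeNineteen, HollowUpper and ColumnStep (at
(3,3,2), because bR<3,3,2> = 14 is a theorem) at once ⇒ close `refuted:ColumnStep`; TwoColumns and
TowerTwoTwo then survive only as
orphan conjectures (hand them to EPRFaces / ShapeSubmodularity as support). A lower bound bR<n,n,2>
>= n^2 + 2n at some n refutes
TwoColumns and ColumnStep ⇒ close. bR<2,2,c> >= 3c+2 at some c refutes TowerTwoTwo and ColumnStep ⇒
close. An approximate scheme
BELOW a predicted value (e.g. <2,4,4> at 22) kills the card's exact law H but NOT this route (upper
half only) — it confirms the cell.
omega = 2 proved elsewhere moots the route, not the law.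

NOT DECOMPOSED YET. The lower half of the hollow law (equalities, a lower-bound programme: border
apolarity cell by cell), rank (non-border) towers (not
affine: R<2,2,3> = 11), the reduced-tensor layer of the Two-layer plan, the no-toric-separation
lemma of the card (P2: any weighting
f(i,j)+g(j,k)+h(k,i) vanishing on the shell vanishes identically — a support statement once a prover
wants it), and all numerics
(kit jobs are the certifier's, seeded by structure).

CHEAPEST FALSIFIER. The exact-value audit of two cells: bR<3,3,3> (19 vs 20) and bR<2,4,4> =
bR<4,4,2> (23 vs printed 26). Done at filing: arXiv:2602.12762
§5.1 (2026, Kronecker–Koszul / tangency flattenings) re-proves bR<2,2,2> = 7 and does NOT treat M_3;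
arXiv:2606.13408 (2026 catalogue)
is exact-rank only (R<2,4,4> = 26, no border track); LandsbergGCT2017 pp. 64, 109 read (gluing
exercise; "reasonable to expect
3m-1 / 3n+1"); tree facts BorderRankMatMulSmall.lean (7, 10, 14, [17,20], LM 2n^2-log n-1) all
consistent with X. Smirnov 2013's
tables (doi:10.1134/s0965542513120129) and Landsberg–Ryder 2017 are NOT held — wants acq-03185,
acq-06243 filed; a refuter with the
tables should first look for any approximate <2,4,4> / <2,3,4> / <3,3,4> scheme and any lower bound
above P.

NUMBERS. P(a,b,c) = abc - (a-1)(b-1)(c-1): cubes 7, 19, 37, 61, 91 (centered hexagonal), log_n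
P(n,n,n) = 2.81, 2.68, 2.60, 2.47 (n=8), 2.26
(n=64) -> 2. Exact border ranks known: bR<a,b,1> = ab; bR<2,2,2> = 7 (Landsberg2005); bR<2,2,3> =
10, bR<2,3,3> = 14
(ConnerHarperLandsberg2023 Thms 1.3, 1.4); 17 <= bR<3,3,3> <= 20 (CHL Thm 1.1; Smirnov2013);
bR<2,2,4> <= 13, bR<2,2,5> <= 16
(reduced gluing 5+8, 8+8); bR<n,n,w> >= 2nw - w + m - floor(...) (LandsbergMichalek2018 Thm 1.1,
below P everywhere); LO slope:
bR<n,n,l> >= (2n-1) l (LandsbergOttaviani2015), P's slope is exactly 2n-1 with defect (n-1)^2.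
Record omega < 2.3714; X would give
omega = 2 with the explicit certificate family 3n^2-3n+1. Items at open: 8 (5 cruxes, 1 target, 1
support, 1 assembly).

DEFINITION REQUESTS. None: `algBorderRank` (SchoenhageTau.lean), `matMulTensor`, `omega`
(MatrixMultiplicationExponent.lean) exist; the glue uses the
PROVED `rpow_omega_div_three_le_algBorderRank_matMulTensor` (CoppersmithWinograd1982Crude.lean) and
`omega_two_le`. Cite wants filed:
Smirnov2013 tables (acq-03185), Landsberg–Ryder Exp. Math. 2017 (acq-06243). A prover closing
TwoColumns at n = 3 or CubeNineteen's
lower context will want the cyclic-symmetry lemma bR<u,v,w> = bR<v,w,u> for `algBorderRank ∘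
matMulTensor` (RectangularExponentSymmetry-type; to be located or filed by the prover).

Novelty: Searches (2026-08-16): hub: all 54 open route headers (lever list in NOTES.md — none inducts on the
format or states a rectangular border
law), Ideas index 170 cards (spine = hollow-schoolbook-law, mechhunt 2026-08-15; related:
shape-submodularity-border-mrr2 (routed),
epr-faces-amortised-module-border-rank (routed), streams-hit-landsberg-ottaviani (superseded),
kronecker-ratio-law, polylog-dual-exponent),
`ledger negatives --problem MatrixMultiplication` (6, unrelated); `lit frontier MatrixMultiplication
--since 2023` (30 rows; read
arXiv:2602.12762 §5.1, arXiv:2601.08119, arXiv:2606.13408 p.10/35-36); `lit search --hybrid "border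
rank matrix multiplication 3x3 lower
bound"` (15 rows: LandsbergGCT2017, BCS1997, ...); `lit search --hybrid "border rank algorithms n x
2 by 2 x 2 ..."`; `lit read
book:landsberg2017 --grep '3n+1|langle n,2,2|reasonable to expect'` (pp. 64, 109, 318); `lit galaxy
search "universal sequence of
tensors ..." --star all` (0); remote OpenAlex/S2/arXiv rate-limited (429) this session — recorded.
Nearest prior art found: LandsbergGCT2017 §4.8 p.109 ("reasonable to expect bR(M^red_<m,2,2>) <=
3m-1, hence bR<n,2,2> <= 3n+1") with
Ex. 3.2.2.1 (reduced gluing) — the (2,2) tower only; ConnerHarperLandsberg2023 (10, 14, 17);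
LandsbergOttaviani2015 (slope n+m-1);
hub card hollow-schoolbook-law (the exact tri-affine law H, both halves, all formats — this route's
spine).
Delta: the route isolates the omega-bearing UPPER half of H as one inductive crux (ColumnStep  [refs: 2602.12762, 2601.08119, 2606.13408, book:landsberg2017, LandsbergGCT2017, ConnerHarperLandsberg2023, LandsbergOttaviani2015]

Barriers (technique_class: border-rank-small-formats, format-induction): - technique_class: border-rank-small-formats, format-induction
- Literature.Barriers.MatrixMultiplication.InfimumNotMinimumBarrier: respected and illustrated — no
single format certifies omega = 2 (log_n(3n^2-3n+1) > 2 for every n); the law certifies 2 only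
through the whole cube sequence, exactly as the barrier demands.
- Literature.Barriers.MatrixMultiplication.LinearRankMethodBarrier: not an obstruction to an
UPPER-bound line; relevant only to refuters confirming/killing cells, and 3n^2-3n+1 < 6n^2-4 keeps
even the lower halves inside the reach of determinantal methods in principle.
- Literature.Barriers.MatrixMultiplication.IrreversibilityBarrier: not in class — no fixed
intermediate tensor, no Kronecker-power degeneration; each cell is a direct border scheme of a
matrix multiplication format.
- Literature.Barriers.MatrixMultiplication.UniversalMethodBarrier: not in class (no T-method /
monomial degeneration of powers of one tensor).
- Literature.Barriers.MatrixMultiplication.UnstableTensorBarrier: not in class (matrix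
multiplication tensors are polystable; no unstable intermediate).
- Literature.Barriers.MatrixMultiplication.RectangularBarrier: not in class — it bounds what
laser-type methods on CW-like tensors give for rectangular exponents; here rectangular formats are
the induction variable, not a method input.
- Literature.Barriers.MatrixMultiplication.TricoloredSumFreeBarrier / YoungSubgroupBarrier /
QuasirandomBarrier / NilpotentGroupBarrier / NormalizerBarrier / E

History (route lifecycle, newest last):
- 2026-08-24T06:57:51Z · DORMANT — reconciler: no traction for 6.6 d (last activity item-evidence-added at 2026-08-17T16:37:18Z); parked, not closed — `ledger route dormant route-MatrixMultiplica (operator:999:3864783)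

sub-problem: MatrixMultiplication · status: dormant · opened planner-plan-lens-MatrixMultiplication-strengthen-v2-g2-0 2026-08-16T16:52:20Z · rev 2 · ledger route-MatrixMultiplication-HollowSchoolbook
GENERATED by the gate from the ledger (D-0016/17). Provers cite these decls: `theorem foo : Summit.MatrixMultiplication.MatrixMultiplication.Theses.HollowSchoolbook.<Decl> := …` in Summits/MatrixMultiplication/MatrixMultiplication/Theorems/<Name>.lean.
-/

namespace Summit.MatrixMultiplication.MatrixMultiplication.Theses.HollowSchoolbook

open scoped BigOperators Topology Manifold Classical MeasureTheory ProbabilityTheory Matrix InnerProductSpace ComplexConjugate ContinuousMap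
open Filter Set Function TopologicalSpace MeasureTheory

attribute [summit_statement] _root_.MatrixMultiplication

/-- item stmt-MatrixMultiplication-15897 · target · rank 0 · open · by planner
why it might fail: maximal optimism made precise: it predicts bR<n,n,n> <= 3n^2-3n+1 (19, 37, 61) while every known construction is >= n^2.37; any lower bound above abc-(a-1)(b-1)(c-1) at ONE cell (first candidate: bR<3,3,3> = 20) kills it.
sources: ConnerHarperLandsberg2023, Landsberg2005, LandsbergGCT2017, LandsbergMichalek2018, Bini1980
[target] the upper hollow law X: for all a, b, c >= 1, bR<a,b,c> + (a-1)(b-1)(c-1) <= abc (shifted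
variables). -/
@[route_item "route-MatrixMultiplication-HollowSchoolbook"]
def HollowUpper : Prop :=
  ∀ a b c : ℕ, Literature.Computability.AlgebraicComplexity.algBorderRank (Literature.Computability.AlgebraicComplexity.matMulTensor ℂ (a + 1) (b + 1) (c + 1)) + a * b * c ≤ (a + 1) * (b + 1) * (c + 1)

/-- item stmt-MatrixMultiplication-15898 · crux · rank 2 · open · by planner
why it might fail: bR<3,3,3> = 20 refutes it at (3,3,2->3) since bR<3,3,2> = 14 is known; no uniform absorbing construction exists beyond the (2,2) reduced-tensor gluing, and the naive Schönhage transfer fails (its order-0 junk Sum A_ij beta_j gamma'_i has rank ab, not 1).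
sources: LandsbergGCT2017, ConnerHarperLandsberg2023, BiniEtAl1979, AlekseevSmirnov2013, Schonhage1981
[crux] the COLUMN STEP (card K3): for all a, b, c >= 1, bR<a,b,c+1> <= bR<a,b,c> + a + b - 1 — the
new column's (a-1)(b-1) interior products are absorbed into eps-cross-terms of the existing scheme,
only the hook of a+b-1 products is paid (shifted: a+1, b+1, c+1). [difficulty: open-problem] -/
@[route_item "route-MatrixMultiplication-HollowSchoolbook", crux]
def ColumnStep : Prop :=
  ∀ a b c : ℕ, Literature.Computability.AlgebraicComplexity.algBorderRank (Literature.Computability.AlgebraicComplexity.matMulTensor ℂ (a + 1) (b + 1) (c + 2)) ≤ Literature.Computability.AlgebraicComplexity.algBorderRank (Literature.Computability.AlgebraicComplexity.matMulTensor ℂ (a + 1) (b + 1) (c + 1)) + a + b + 1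

/-- item stmt-MatrixMultiplication-15899 · crux · rank 3 · open · by planner
why it might fail: asks a factor-2 border saving (n^2+2n-1 vs 2n^2) with no construction for n >= 4 (first open cell <4,4,2> @ 23 vs printed 26 = 2 bR<2,2,4>); a Koszul / Kronecker–Koszul flattening bound >= n^2+2n at any single n kills it.
sources: Landsberg2005, ConnerHarperLandsberg2023, LandsbergOttaviani2015, HopcroftKerr1971, arXiv:2602.12762
[crux] the first column step for square A: bR<n,n,2> <= n^2 + 2n - 1 = (n+1)^2 - 2 for all n >= 1 —
an n x n matrix times TWO vectors costs barely more than one matrix–vector product in the border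
limit (shifted: n+1); proved for n <= 3 (7; 14 = bR<3,3,2> by CHL Thm 1.4 and cyclic symmetry).
[difficulty: L] -/
@[route_item "route-MatrixMultiplication-HollowSchoolbook"]
def TwoColumns : Prop :=
  ∀ n : ℕ, Literature.Computability.AlgebraicComplexity.algBorderRank (Literature.Computability.AlgebraicComplexity.matMulTensor ℂ (n + 1) (n + 1) 2) ≤ n ^ 2 + 4 * n + 2

/-- item stmt-MatrixMultiplication-8008 · crux · rank 4 · open · by planner
why it might fail: every numerical search since Smirnov 2013 stops at 20, and CHL's Borel-fixed census at r = 18, 19 (their named next step) or a Kronecker–Koszul flattening may prove bR<3,3,3> = 20.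
sources: Smirnov2013, ConnerHarperLandsberg2023, LandsbergGCT2017, arXiv:2602.12762
[crux] bR(⟨3,3,3⟩) ≤ 19 over ℂ[ε] (card C2; format 9×9×9). Window [17,20]: 17 by border apolarity
(ConnerHarperLandsberg2023), 20 by Smirnov2013 (numerical then exact), 21 = Schönhage's order-2
pattern (BCS Ex. 15.8). Engine: patterns of order h ≤ 2 with a stabiliser of order ≥ 3 in (S_3 ≀
transpose/cyclic) × torus — the border analogue of the symmetric-scheme searches; a 19 reads ω ≤
log_27 19³ = 2.68 and is the first movement at 3×3 since 2013. [deps: TwoSquaresThirteen]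
[difficulty: open-problem] -/
@[route_item "route-MatrixMultiplication-HollowSchoolbook"]
def CubeNineteen : Prop :=
  Literature.Computability.AlgebraicComplexity.algBorderRank (Literature.Computability.AlgebraicComplexity.matMulTensor ℂ 3 3 3) ≤ 19

/-- item stmt-MatrixMultiplication-15900 · crux · rank 5 · open · by planner
why it might fail: needs a scheme 3 below anything printed for <2,4,4>; plain ALS with eps-parametrisation did not even re-find the known <2,2,4>@13 / <3,3,3>@20 in hub probes (card j003631), so structure (Z_2 x Z_2 symmetry, reduced-tensor gluing) must seed the search.
sources: AlekseevSmirnov2013, HopcroftKerr1971, arXiv:2606.13408, Smirnov2013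
[crux] the cheapest new cell: bR<4,4,2> <= 23 (= TwoColumns at n = 4; <4,4,2> ~ <2,4,4> cyclically;
printed: R<2,4,4> = 26, bR <= 26 via 2 x bR<2,2,4> = 2 x 13) — a computational crux: an approximate
scheme of length 23 in format 16 x 8 x 8 with a rational eps-certificate. [difficulty: M] -/
@[route_item "route-MatrixMultiplication-HollowSchoolbook"]
def FourFourTwo : Prop :=
  Literature.Computability.AlgebraicComplexity.algBorderRank (Literature.Computability.AlgebraicComplexity.matMulTensor ℂ 4 4 2) ≤ 23

/-- item stmt-MatrixMultiplication-15901 · crux · rank 6 · open · by planner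
why it might fail: needs bR(M^red_<m,2,2>) <= 3m-1 for all m (printed only for m <= 3) or another gluing; Landsberg–Ryder's geometry of the limit planes (three lines / conic + P^1 x P^1) may not persist for m >= 4, and a lower bound 3c+2 at one c kills it.
sources: LandsbergGCT2017, BiniEtAl1979, AlekseevSmirnov2013, LandsbergMichalek2018
[crux] Landsberg's expectation for the (2,2) tower: bR<2,2,c> <= 3c + 1 for all c >= 1 (shifted:
c+1); = ColumnStep at (a,b) = (2,2); known for c <= 5 (4, 7, 10, 13, 16) by gluing the reduced
tensors M^red_<2,2,2> (BCLR, 5) and M^red_<3,2,2> (Alekseev–Smirnov, 8). [difficulty: L] -/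
@[route_item "route-MatrixMultiplication-HollowSchoolbook"]
def TowerTwoTwo : Prop :=
  ∀ c : ℕ, Literature.Computability.AlgebraicComplexity.algBorderRank (Literature.Computability.AlgebraicComplexity.matMulTensor ℂ 2 2 (c + 1)) ≤ 3 * c + 4

/-- item stmt-MatrixMultiplication-15902 · support · rank 9 · open · by planner
sources: LandsbergGCT2017, Blaser2013
[support] the column step gives the upper hollow law by induction on the number of columns (base
bR<a,b,1> <= ab = the standard algorithm; the step adds a+b-1 and ab + (c-1)(a+b-1) + (a+b-1) = ab +
c(a+b-1)); PROVED sorry-free in the planner's Sketch.lean (nlinarith bookkeeping), to be re-landed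
by a prover. [difficulty: provable-now] -/
@[route_item "route-MatrixMultiplication-HollowSchoolbook"]
def StepGivesHollow : Prop :=
  ColumnStep → HollowUpper

/-- item stmt-MatrixMultiplication-15903 · assembly · rank 1 · open · by planner
sources: Bini1980, Schonhage1981, Blaser2013
[assembly] HollowUpper → MatrixMultiplication (the second half of `closes`; real-analysis
bookkeeping over the proved Bini inequality). -/
@[route_item "route-MatrixMultiplication-HollowSchoolbook"]
def Assembly : Prop :=
  HollowUpper → _root_.MatrixMultiplication

/-! D-0027 §2.1 — DECIDING THEOREM (planner-authored via `route open/edit --closes-file`; by planner-plan-lens-MatrixMultiplication-strengthen-v2-g2-0 2026-08-16T16:52:20Z):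
its hypotheses are this route's items and its conclusion the sub-problem Statement (glue_lint), and it elaborates with this file. -/

@[closes "route-MatrixMultiplication-HollowSchoolbook"] theorem closes (hstep : ColumnStep) : _root_.MatrixMultiplication := by
  -- Step 1: the hollow upper law bR⟨a+1,b+1,c+1⟩ + abc ≤ (a+1)(b+1)(c+1), by induction on c
  -- from the column step (base: the standard algorithm for ⟨a+1,b+1,1⟩).
  have hollow : ∀ a b c : ℕ,
      Literature.Computability.AlgebraicComplexity.algBorderRank
          (Literature.Computability.AlgebraicComplexity.matMulTensor ℂ (a + 1) (b + 1) (c + 1)) + a * b * c ≤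
        (a + 1) * (b + 1) * (c + 1) := by
    intro a b c
    induction c with
    | zero =>
      have hb := (Literature.Computability.AlgebraicComplexity.algBorderRank_le_tensorRank
        (Literature.Computability.AlgebraicComplexity.matMulTensor ℂ (a + 1) (b + 1) (0 + 1))).trans
        (Literature.Computability.AlgebraicComplexity.tensorRank_matMulTensor_le ℂ (a + 1) (b + 1) (0 + 1))
      nlinarith [hb]
    | succ c ih =>
      have h2 := hstep a b c
      nlinarith [ih, h2]
  -- Step 2: ω(ℂ) = 2.
  show Literature.Computability.AlgebraicComplexity.omega ℂ = 2
  refine le_antisymm ?_ (Literature.Computability.AlgebraicComplexity.omega_two_le ℂ)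
  refine le_of_forall_pos_le_add fun ε hε => ?_
  -- choose N = m + 2 with N > 3^(1/ε), so that 3 < N^ε
  obtain ⟨m, hm⟩ := exists_nat_gt ((3 : ℝ) ^ (1 / ε))
  set N : ℕ := m + 2 with hNdef
  have hN1 : (1 : ℝ) < N := by
    have : (2 : ℝ) ≤ N := by exact_mod_cast (by omega : 2 ≤ N)
    linarith
  have hN0 : (0 : ℝ) ≤ N := by linarith
  have hNgt : (3 : ℝ) ^ (1 / ε) < N := by
    have : (m : ℝ) ≤ N := by exact_mod_cast (by omega : m ≤ N)
    linarith
  have h3 : (3 : ℝ) ≤ (N : ℝ) ^ ε := by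
    have h30 : (0 : ℝ) ≤ (3 : ℝ) ^ (1 / ε) := Real.rpow_nonneg (by norm_num) _
    have hlt := Real.rpow_lt_rpow h30 hNgt hε
    have hid : ((3 : ℝ) ^ (1 / ε)) ^ ε = 3 := by
      rw [← Real.rpow_mul (by norm_num : (0 : ℝ) ≤ 3), one_div, inv_mul_cancel₀ hε.ne', Real.rpow_one]
    rw [hid] at hlt
    exact hlt.le
  -- the cube bound: bR⟨N,N,N⟩ ≤ 3 N^2 (from hollow at a = b = c = m + 1)
  have hcube := hollow (m + 1) (m + 1) (m + 1)
  have hcubeR : (Literature.Computability.AlgebraicComplexity.algBorderRank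
      (Literature.Computability.AlgebraicComplexity.matMulTensor ℂ N N N) : ℝ) ≤ 3 * (N : ℝ) ^ 2 := by
    have hnat : Literature.Computability.AlgebraicComplexity.algBorderRank
        (Literature.Computability.AlgebraicComplexity.matMulTensor ℂ N N N) ≤ 3 * N ^ 2 := by
      have e1 : N = m + 1 + 1 := by omega
      rw [e1]
      nlinarith [hcube]
    exact_mod_cast hnat
  -- Bini / ASI with one block: (N·N·N)^{ω/3} ≤ bR⟨N,N,N⟩
  have hASI := Literature.Computability.AlgebraicComplexity.rpow_omega_div_three_le_algBorderRank_matMulTensor ℂ N N N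
  have hpow : ((N * N * N : ℕ) : ℝ) ^ (Literature.Computability.AlgebraicComplexity.omega ℂ / 3) =
      (N : ℝ) ^ Literature.Computability.AlgebraicComplexity.omega ℂ := by
    have e : ((N * N * N : ℕ) : ℝ) = (N : ℝ) ^ (3 : ℝ) := by
      push_cast
      rw [show (3 : ℝ) = ((3 : ℕ) : ℝ) by norm_num, Real.rpow_natCast]
      ring
    rw [e, ← Real.rpow_mul hN0]
    congr 1
    ring
  rw [hpow] at hASI
  -- N^ω ≤ 3 N^2 ≤ N^ε N^2 = N^(2+ε)
  have hle : (N : ℝ) ^ Literature.Computability.AlgebraicComplexity.omega ℂ ≤ (N : ℝ) ^ (2 + ε) := by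
    have h2 : (N : ℝ) ^ (2 + ε) = (N : ℝ) ^ (2 : ℝ) * (N : ℝ) ^ ε := by
      rw [Real.rpow_add (by linarith)]
    have h2' : (N : ℝ) ^ (2 : ℝ) = (N : ℝ) ^ 2 := by
      rw [show (2 : ℝ) = ((2 : ℕ) : ℝ) by norm_num, Real.rpow_natCast]
    rw [h2, h2']
    have hsq : (0 : ℝ) ≤ (N : ℝ) ^ 2 := by positivity
    calc (N : ℝ) ^ Literature.Computability.AlgebraicComplexity.omega ℂ
        ≤ (Literature.Computability.AlgebraicComplexity.algBorderRank
            (Literature.Computability.AlgebraicComplexity.matMulTensor ℂ N N N) : ℝ) := hASI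
      _ ≤ 3 * (N : ℝ) ^ 2 := hcubeR
      _ = (N : ℝ) ^ 2 * 3 := by ring
      _ ≤ (N : ℝ) ^ 2 * (N : ℝ) ^ ε := mul_le_mul_of_nonneg_left h3 hsq
  exact (Real.rpow_le_rpow_left_iff hN1).1 hle

end Summit.MatrixMultiplication.MatrixMultiplication.Theses.HollowSchoolbook
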